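import Summits.QuantumFields.QCD.Theses.WilsonMobilityGap

/-!
# QuantumFields / QCD — route `WilsonMobilityGap`, the assembly `Assembly` (stmt-QuantumFields-17563)

Route `QCD/WilsonMobilityGap` (the Aoki boundary as a mobility edge), item stmt-QuantumFields-17563
(`Assembly`, rank 1), the re-pinned thesis line after the statement re-type p117723 (`QCDOf` gained
the chiral pin `reg.IsChiralAtZero`):

  `ChiralMobilityGap ∧ PhaseQuenchedFlavourDecay ∧ ChiralGluonicCompletion → QCD`.

This is the uncurried form of the route file's kernel-checked deciding theorem
`Summit.QuantumFields.QCD.Theses.WilsonMobilityGap.closes` (D-0027 §2.1, rev 8), whose three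
hypotheses are exactly the three conjuncts, in the same order, and whose conclusion is the
sub-problem constant `_root_.QCD` (`= QCDOf 2 ∧ QCDOf 3`) of
`Summits/QuantumFields/QCD/Statement.lean`.  The assembly therefore closes by destructuring the
conjunction and applying `closes`; no mathematics beyond the route's own glue (for `N_f ∈ {2, 3}`:
`ChiralMobilityGap` supplies ONE regularisation with mass scaling, the chiral pin and asymptotic
scaling together with its per-mass clauses (i)–(iv); `PhaseQuenchedFlavourDecay` turns clause (ii)
into the flavour-charged phase-quenched decay; `ChiralGluonicCompletion` consumes exactly that
pinned package and returns `QCDOf N_f`).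

History: the same theorem name and the same by-name proof text closed the earlier, unpinned
assembly item stmt-QuantumFields-11071 (`MobilityGap ∧ PhaseQuenchedFlavourDecay ∧
GluonicCompletion → QCD`, route rev 6); since the proof only cites `Assembly` and `closes` by name,
it elaborates unchanged against the re-typed route file, and this revision refreshes the
documentation to the current statement.

Design note: this module imports the Theses module (the statement is cited BY NAME, as the gate's
closing probe requires), so the gate records the closure as the docstring link in the route file
rather than as an in-file `Assembly_holds` theorem (a re-import would be an import cycle).

References: A. Jaffe, E. Witten, *Quantum Yang–Mills theory* (Clay problem description, 2000);
M. Golterman, Y. Shamir, Phys. Rev. D 68 (2003) 074501.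
-/

namespace Summit.QuantumFields.QCD.Theorems

/-- **Assembly of route `WilsonMobilityGap`** (item stmt-QuantumFields-17563):
`ChiralMobilityGap ∧ PhaseQuenchedFlavourDecay ∧ ChiralGluonicCompletion → QCD`.  Pure logic: the
statement is the uncurried type of the route's proved deciding theorem
`Theses.WilsonMobilityGap.closes`; destructure the three-fold conjunction and apply it. [folklore] -/
theorem wilsonMobilityGap_assembly_proof :
    Summit.QuantumFields.QCD.Theses.WilsonMobilityGap.Assembly := by
  unfold Summit.QuantumFields.QCD.Theses.WilsonMobilityGap.Assembly
  rintro ⟨h₁, h₂, h₃⟩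
  exact Summit.QuantumFields.QCD.Theses.WilsonMobilityGap.closes h₁ h₂ h₃

end Summit.QuantumFields.QCD.Theorems
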